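import Summits.CriticalPhenomena.PercolationContinuityZ3.Theorems.Transplant.GrigorchukOneEnd
import Summits.CriticalPhenomena.PercolationContinuityZ3.Theorems.Transplant.GrigorchukLamplighterSubexponentialGrowth
import Summits.CriticalPhenomena.PercolationContinuityZ3.Theorems.Transplant.GrigorchukLamplighterBlockCharKernel
import Summits.CriticalPhenomena.PercolationContinuityZ3.Theorems.Transplant.GrigorchukLamplighterStandardGensNoSkeleton
import HarnessLib

/-!
# THE FRONTIER GRAPH `Cay(ℤ ≀_X 𝔊; a, b, c, d, s)` — indeed EVERY Cayley graph of `Γ₂ = ℤ ≀_X 𝔊` — has EXACTLY ONE END, by the commuting-pair criterion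
# (the lamps-and-rigid-stabiliser subgroups of the two level-one subtrees); a consistency instance of B–S Question 3 / L–P Conj. 7.27 on V164's graph

builds on p205010 (kernel theorem, internal audit signed; external expert review pending) — nothing in this file uses p205010; V164's statement is untouched,
nothing about `θ(p_c)`, no node.  Lane `prim-bschramm`, seat `prim-bschramm-gen-1` gen 10 (GEN pen; offer O-OE3, lead g27 GO 2026-08-28T16:56Z #8581, refuter
p5-g33).  Helper file (`--supports stmt-CriticalPhenomena-4575 --as helper`).  Def-free (proof lane); no instance, no notation.  The two subgroups are
PROOF-INTERNAL `Subgroup.closure` terms: for `ε ∈ {false, true}`, `H_ε = ⟨ tree(T_ε) ∪ { lamp (cons ε (r·ρ)) 1 : r = (ad)^i a^j, i < 4, j < 2 } ⟩`, `T_ε` a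
finite generating set of `ristG ε` (p606245 `ristG_fg`).
* (i) COMMUTE: generator by generator — `rist false`/`rist true` commute (p606245), an element of `rist ε` FIXES every ray beginning with `!ε` so it fixes the
  other side's lamps («…Defs» `tree_mul_lamp_mul_tree_inv`), lamps commute; closures of commuting sets commute (`commute_of_mem_closure`, centralizers).
* (ii) MEET TRIVIALLY: every `h ∈ H_ε` has `h.right ∈ rist ε` and lamp support inside `{x | x 0 = ε}` (`closure_invariant`; `apply_zero_of_mem_rist`).
* (iii) INFINITE (`⊇ tree(ristG ε)`, p606245 `ristG_infinite`); (iv) FINITELY GENERATED (finite generating set by construction).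
* (v) CO-BOUNDED with `F = tree(F_𝔊)`, `F_𝔊` from «GrigorchukOneEnd» `exists_ristG_coset_reps` (p650326): `γ·tree f = (λ, a·b)`, and the lamp configuration `λ`
  (supported on `X = 𝔊ρ`, «…BlockCharKernel» `exists_apply_rho_of_mem_support`) splits by first letter into `λ_F ∈ H_false`, `λ_T ∈ H_true` — a ray of `X`
  beginning with `ε` is `α·(cons ε (r·ρ))`, `α ∈ ristG ε`, `r = (ad)^i a^j` (`exists_ristG_apply_cons_eq`: `mem_stabOne_or` p593398, `apply_cons` p590401,
  `exists_rep_mod_normalClosureB` + `normalClosureB_le_range_secR` p606245) — so `γ·tree f = (λ_F·tree a)·(λ_T·tree b)`.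
Then «CommutingPairOneEnd» `OneEnd.end_existsUnique_of_commuting_subgroups` (p649557): **`wreathZ_cayley_gens_existsUnique_end`** (every finite generating `S`),
**`cay_existsUnique_end`** (the frontier graph `Cay`), and the consistency instance **`cay_question3_instance`** (`p_u < 1` there is p624625).  In print the
one-endedness of such groups follows from Stallings' theorem; the tree's proof is the elementary commuting pair.  NOT CLAIMED: `wreathZ2 = ℤ² ≀_X 𝔊` or any
other lamp group (the same proof would apply — not offered); the nodes `BenjaminiSchramm1996_question3` / `LyonsPeres2016_conj_7_27` stay OPEN.
[cite: BartholdiErschler2012, §2 (W = Σ_X A ⋊ G, X = ρG), §3.1 (St(1), ψ)] [cite: MuchnikPak2001, Lemma 2 and Cor. 1] [cite: BenjaminiSchramm1996, Def. 1 (p. 75),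
Question 3 (p. 79)] [cite: LyonsPeres2016, §7.6 Conj. 7.27, Thm. 7.6]
-/

noncomputable section

namespace Summit.CriticalPhenomena.PercolationContinuityZ3.Theorems.Transplant

namespace Grigorchuk

open SimpleGraph SemidirectProduct Literature.Barriers.CriticalPhenomena Literature.Probability.Percolation Literature.Probability.LatticeModels
open scoped Classical

/-! ## §1 Rays of the orbit by first letter; lamps of `Γ₂`; two closure lemmas (reused: «…InvertedOrbits» `rho_eq_cons`, «…StandardGensNoSkeleton» `lamp_zpow`) -/

/-- **FIRST-LETTER NORMAL FORM of an orbit ray**: `g·ρ` (`g ∈ 𝔊`) beginning with `ε` equals `α·(cons ε (r·ρ))` for some `α ∈ ristG ε` and one of the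
eight representatives `r = (ad)^i a^j` of `𝔊 ⧸ B` (`[𝔊 : St(1)] = 2`, sections, `B ≤ φ_ε(ristG ε)`). [cite: BartholdiErschler2012, §3.1] [cite: MuchnikPak2001, Lemma 2] -/
theorem exists_ristG_apply_cons_eq {g : Equiv.Perm Ray} (hg : g ∈ grigorchukGroup) (ε : Bool) (hε : g rho 0 = ε) :
    ∃ α ∈ ristG ε, ∃ i < 4, ∃ j < 2,
      ((α : ↥grigorchukGroup) : Equiv.Perm Ray) (cons ε ((((aG * dG) ^ i * aG ^ j : ↥grigorchukGroup) : Equiv.Perm Ray) rho)) = g rho := by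
  -- `g ρ = cons ε (φ_ε(h) ρ)` for some `h ∈ St_𝔊(1)`
  have key : ∃ h : ↥stabOne, (h : Equiv.Perm Ray) ∈ grigorchukGroup ∧ g rho = cons ε (sec ε h rho) := by
    rcases mem_stabOne_or hg with ⟨hs, -⟩ | ⟨hs, hsa⟩
    · have e : g rho = cons true (sec true ⟨g, hs⟩ rho) := by
        conv_lhs => rw [rho_eq_cons]
        exact apply_cons ⟨g, hs⟩ true rho
      have hε' : ε = true := by rw [← hε, e]; rfl
      subst hε'
      exact ⟨⟨g, hs⟩, hg, e⟩
    · have e : g rho = cons false (sec false ⟨g * genA, hs⟩ rho) := by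
        have e1 : g rho = (g * genA) (cons false rho) := by
          rw [Equiv.Perm.mul_apply, genA_cons, Bool.not_false, ← rho_eq_cons]
        rw [e1]
        exact apply_cons ⟨g * genA, hs⟩ false rho
      have hε' : ε = false := by rw [← hε, e]; rfl
      subst hε'
      exact ⟨⟨g * genA, hs⟩, hsa, e⟩
  obtain ⟨h, hh, e⟩ := key
  -- `φ_ε(h) = β·r` with `β ∈ B ≤ range (secR ε)`
  obtain ⟨i, hi, j, hj, hβ⟩ := exists_rep_mod_normalClosureB ⟨sec ε h, sec_mem_grigorchukGroup h hh ε⟩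
  obtain ⟨α, hα⟩ := normalClosureB_le_range_secR ε hβ
  refine ⟨α, α.2, i, hi, j, hj, ?_⟩
  have hα' : sec ε ⟨((α : ↥grigorchukGroup) : Equiv.Perm Ray), rist_le_stabOne ε α.2⟩ =
      sec ε h * ((((aG * dG) ^ i * aG ^ j : ↥grigorchukGroup)) : Equiv.Perm Ray)⁻¹ := by
    rw [← coe_secR, hα]; rfl
  rw [e, apply_cons ⟨((α : ↥grigorchukGroup) : Equiv.Perm Ray), rist_le_stabOne ε α.2⟩ ε, hα', Equiv.Perm.mul_apply,
    Equiv.Perm.inv_def, Equiv.symm_apply_apply]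

/-- The ray `cons ε (g·ρ)` (`g ∈ 𝔊`) is an orbit ray (sections are onto, p593398). [cite: BartholdiErschler2012, §3.1] -/
theorem exists_apply_rho_eq_cons (ε : Bool) {g : Equiv.Perm Ray} (hg : g ∈ grigorchukGroup) :
    ∃ g' ∈ grigorchukGroup, g' rho = cons ε (g rho) := by
  obtain ⟨h, hh, hsec⟩ := exists_sec_eq true hg
  have e : (h : Equiv.Perm Ray) rho = cons true (g rho) := by
    conv_lhs => rw [rho_eq_cons]
    rw [apply_cons h true rho, hsec]
  cases ε
  · refine ⟨genA * h, grigorchukGroup.mul_mem (Subgroup.subset_closure (by simp)) hh, ?_⟩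
    rw [Equiv.Perm.mul_apply, e, genA_cons, Bool.not_true]
  · exact ⟨h, hh, e⟩

/-- Lamps at orbit rays lie in `Γ₂`: `(g ρ ↦ m) = tree g · s^m · tree g⁻¹ ∈ Γ₂` for `g ∈ 𝔊`. [cite: BartholdiErschler2012, §2] -/
theorem lamp_apply_rho_mem_wreathZ {g : Equiv.Perm Ray} (hg : g ∈ grigorchukGroup) (m : ℤ) : (lamp (g rho) m : LampGroup ℤ) ∈ wreathZ := by
  have hs : (lamp rho m : LampGroup ℤ) ∈ wreathZ := by
    rw [← lamp_zpow]
    exact Subgroup.zpow_mem _ (Subgroup.subset_closure (by simp)) m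
  rw [← tree_mul_lamp_mul_tree_inv]
  exact Subgroup.mul_mem _ (Subgroup.mul_mem _ (tree_mem_wreathZ hg) hs) (Subgroup.inv_mem _ (tree_mem_wreathZ hg))

/-- Subgroups generated by pairwise commuting sets commute elementwise (two passes through centralizers). [folklore] -/
theorem commute_of_mem_closure {G : Type} [Group G] {A B : Set G} (h : ∀ a ∈ A, ∀ b ∈ B, a * b = b * a) :
    ∀ a ∈ Subgroup.closure A, ∀ b ∈ Subgroup.closure B, Commute a b := by
  have h1 : Subgroup.closure A ≤ Subgroup.centralizer B :=
    (Subgroup.closure_le _).2 fun a ha => Subgroup.mem_centralizer_iff.2 fun b hb => (h a ha b hb).symm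
  have h2 : Subgroup.closure B ≤ Subgroup.centralizer ↑(Subgroup.closure A) :=
    (Subgroup.closure_le _).2 fun b hb => Subgroup.mem_centralizer_iff.2 fun a ha => ((Subgroup.mem_centralizer_iff.1 (h1 ha)) b hb).symm
  intro a ha b hb
  exact Subgroup.mem_centralizer_iff.1 (h2 hb) a ha

/-- **The side invariant**: if every generator has tree part in `rist ε` and lamps only at rays beginning with `ε`, so does every element of the closure
(`rist ε` preserves first letters). [cite: BartholdiErschler2012, §2 (sup(g·f) = g·sup f)] -/
theorem closure_invariant (ε : Bool) (G : Set ↥wreathZ)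
    (hG : ∀ w ∈ G, (w : LampGroup ℤ).right ∈ rist ε ∧ ∀ x ∈ (Multiplicative.toAdd (w : LampGroup ℤ).left).support, x 0 = ε) :
    ∀ w ∈ Subgroup.closure G, (w : LampGroup ℤ).right ∈ rist ε ∧ ∀ x ∈ (Multiplicative.toAdd (w : LampGroup ℤ).left).support, x 0 = ε := by
  intro w hw
  induction hw using Subgroup.closure_induction with
  | mem z hz => exact hG z hz
  | one => exact ⟨(rist ε).one_mem, fun x hx => by simp at hx⟩
  | mul y z _ _ hy hz =>
    refine ⟨(rist ε).mul_mem hy.1 hz.1, fun x hx => ?_⟩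
    rw [Subgroup.coe_mul, mul_left, toAdd_mul] at hx
    rcases Finset.mem_union.1 (Finsupp.support_add hx) with h | h
    · exact hy.2 x h
    · rw [toAdd_lampAut_apply, Finsupp.mem_support_iff, Finsupp.equivMapDomain_apply, ← Finsupp.mem_support_iff] at h
      have h' := hz.2 _ h
      rwa [← apply_zero_of_mem_rist hy.1 ((y : LampGroup ℤ).right.symm x), Equiv.apply_symm_apply] at h'
  | inv y _ hy =>
    refine ⟨(rist ε).inv_mem hy.1, fun x hx => ?_⟩
    rw [Subgroup.coe_inv, inv_left, toAdd_lampAut_apply, Finsupp.mem_support_iff, Finsupp.equivMapDomain_apply, toAdd_inv, Finsupp.neg_apply,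
      neg_ne_zero, ← Finsupp.mem_support_iff, Equiv.Perm.inv_def, Equiv.symm_symm] at hx
    rw [← apply_zero_of_mem_rist hy.1 x]
    exact hy.2 _ hx

/-- **Lamp configurations on one side**: if every lamp `(x ↦ m)` at an orbit ray beginning with `ε` lies in `K ≤ Γ₂`, then so does `(λ, 1)` for every
configuration `λ` supported on such rays. [cite: BartholdiErschler2012, §2 (Σ_X A)] -/
theorem inl_ofAdd_mem (ε : Bool) (K : Subgroup ↥wreathZ)
    (hl : ∀ x : Ray, (∃ g ∈ grigorchukGroup, g rho = x) → x 0 = ε → ∀ m : ℤ,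
      ∃ hx : (lamp x m : LampGroup ℤ) ∈ wreathZ, (⟨lamp x m, hx⟩ : ↥wreathZ) ∈ K)
    (f : Ray →₀ ℤ) (hf : ∀ x ∈ f.support, (∃ g ∈ grigorchukGroup, g rho = x) ∧ x 0 = ε) :
    ∃ h : (inl (Multiplicative.ofAdd f) : LampGroup ℤ) ∈ wreathZ, (⟨inl (Multiplicative.ofAdd f), h⟩ : ↥wreathZ) ∈ K := by
  induction f using Finsupp.induction with
  | zero =>
    have e : (inl (Multiplicative.ofAdd (0 : Ray →₀ ℤ)) : LampGroup ℤ) = 1 := by rw [ofAdd_zero, map_one]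
    refine ⟨by rw [e]; exact wreathZ.one_mem, ?_⟩
    have e' : (⟨inl (Multiplicative.ofAdd (0 : Ray →₀ ℤ)), by rw [e]; exact wreathZ.one_mem⟩ : ↥wreathZ) = 1 := Subtype.ext e
    rw [e']
    exact K.one_mem
  | single_add a b f ha hb ih =>
    have hsupp : (Finsupp.single a b + f).support = Finset.cons a f.support ha := Finsupp.support_single_add ha hb
    obtain ⟨hfw, hfK⟩ := ih fun x hx => hf x (by rw [hsupp]; exact Finset.mem_cons_of_mem hx)
    obtain ⟨hga, ha0⟩ := hf a (by rw [hsupp]; exact Finset.mem_cons_self a _)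
    obtain ⟨haw, haK⟩ := hl a hga ha0 b
    have e : (inl (Multiplicative.ofAdd (Finsupp.single a b + f)) : LampGroup ℤ) = lamp a b * inl (Multiplicative.ofAdd f) := by
      rw [ofAdd_add, map_mul]; rfl
    refine ⟨by rw [e]; exact wreathZ.mul_mem haw hfw, ?_⟩
    have e' : (⟨inl (Multiplicative.ofAdd (Finsupp.single a b + f)), by rw [e]; exact wreathZ.mul_mem haw hfw⟩ : ↥wreathZ) =
        ⟨lamp a b, haw⟩ * ⟨inl (Multiplicative.ofAdd f), hfw⟩ := Subtype.ext e
    rw [e']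
    exact K.mul_mem haK hfK

/-! ## §2 Every Cayley graph of `Γ₂` has exactly one end -/

/-- **THE CAYLEY GRAPHS OF `Γ₂ = ℤ ≀_X 𝔊` ARE ONE-ENDED**: for every finite generating set `S`, `Cay(Γ₂; S)` has EXACTLY ONE END (Mathlib `SimpleGraph.end`) — the
commuting pair `H_false`, `H_true` (lamps + rigid stabiliser of each level-one subtree) in «CommutingPairOneEnd»'s criterion.
[cite: BartholdiErschler2012, §2, §3.1] [cite: MuchnikPak2001, Lemma 2 and Cor. 1] [cite: LyonsPeres2016, §7.6] -/
theorem wreathZ_cayley_gens_existsUnique_end (S : Finset ↥wreathZ) (hS : Subgroup.closure (↑S : Set ↥wreathZ) = ⊤) :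
    ∃! e, e ∈ (mulCayley (↑S : Set ↥wreathZ)).end := by
  -- finite generating sets of the rigid stabilisers; tree letters and the eight lamps of each side as elements of `Γ₂`
  choose T hT using fun ε : Bool => ristG_fg ε
  let treeW : ↥grigorchukGroup → ↥wreathZ := fun α => ⟨tree (α : Equiv.Perm Ray), tree_mem_wreathZ α.2⟩
  have treeW_mul : ∀ α β, treeW (α * β) = treeW α * treeW β := fun α β => Subtype.ext (by
    change (inr (((α * β : ↥grigorchukGroup)) : Equiv.Perm Ray) : LampGroup ℤ) = inr (α : Equiv.Perm Ray) * inr (β : Equiv.Perm Ray)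
    rw [Subgroup.coe_mul, map_mul])
  have treeW_one : treeW 1 = 1 := Subtype.ext (by change (inr ((1 : ↥grigorchukGroup) : Equiv.Perm Ray) : LampGroup ℤ) = 1; rw [Subgroup.coe_one, map_one])
  have treeW_inv : ∀ α, treeW α⁻¹ = (treeW α)⁻¹ := fun α => by
    rw [eq_inv_iff_mul_eq_one, ← treeW_mul, inv_mul_cancel, treeW_one]
  have treeW_inj : Function.Injective treeW := fun α β h =>
    Subtype.ext (inr_injective (congrArg Subtype.val h : (tree (α : Equiv.Perm Ray) : LampGroup ℤ) = tree (β : Equiv.Perm Ray)))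
  let rep : ℕ × ℕ → ↥grigorchukGroup := fun p => (aG * dG) ^ p.1 * aG ^ p.2
  have hrepW : ∀ (ε : Bool) (p : ℕ × ℕ), (lamp (cons ε (((rep p : ↥grigorchukGroup) : Equiv.Perm Ray) rho)) 1 : LampGroup ℤ) ∈ wreathZ := by
    intro ε p
    obtain ⟨g', hg', e⟩ := exists_apply_rho_eq_cons ε (rep p).2
    rw [← e]
    exact lamp_apply_rho_mem_wreathZ hg' 1
  let lampW : Bool → ℕ × ℕ → ↥wreathZ := fun ε p => ⟨lamp (cons ε (((rep p : ↥grigorchukGroup) : Equiv.Perm Ray) rho)) 1, hrepW ε p⟩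
  let G : Bool → Set ↥wreathZ := fun ε => treeW '' ↑(T ε) ∪ lampW ε '' ↑(Finset.range 4 ×ˢ Finset.range 2)
  set H : Bool → Subgroup ↥wreathZ := fun ε => Subgroup.closure (G ε) with hH
  -- (a) tree letters of `ristG ε` lie in `H ε`
  have treeW_mem : ∀ (ε : Bool), ∀ α ∈ ristG ε, treeW α ∈ H ε := by
    intro ε α hα
    rw [← hT ε] at hα
    induction hα using Subgroup.closure_induction with
    | mem z hz => exact Subgroup.subset_closure (Set.mem_union_left _ ⟨z, hz, rfl⟩)
    | one => rw [treeW_one]; exact (H ε).one_mem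
    | mul y z _ _ hy hz => rw [treeW_mul]; exact (H ε).mul_mem hy hz
    | inv y _ hy => rw [treeW_inv]; exact (H ε).inv_mem hy
  -- (b) lamps at orbit rays beginning with `ε` lie in `H ε`
  have lamp_mem : ∀ (ε : Bool) (x : Ray), (∃ g ∈ grigorchukGroup, g rho = x) → x 0 = ε → ∀ m : ℤ,
      ∃ hx : (lamp x m : LampGroup ℤ) ∈ wreathZ, (⟨lamp x m, hx⟩ : ↥wreathZ) ∈ H ε := by
    rintro ε x ⟨g, hg, rfl⟩ hε m
    obtain ⟨α, hα, i, hi, j, hj, e⟩ := exists_ristG_apply_cons_eq hg ε hε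
    refine ⟨lamp_apply_rho_mem_wreathZ hg m, ?_⟩
    have key : (⟨lamp (g rho) m, lamp_apply_rho_mem_wreathZ hg m⟩ : ↥wreathZ) = treeW α * lampW ε (i, j) ^ m * (treeW α)⁻¹ := by
      refine Subtype.ext ?_
      change (lamp (g rho) m : LampGroup ℤ) =
        tree (α : Equiv.Perm Ray) * (lamp (cons ε (((rep (i, j) : ↥grigorchukGroup) : Equiv.Perm Ray) rho)) 1) ^ m * (tree (α : Equiv.Perm Ray))⁻¹
      rw [lamp_zpow, tree_mul_lamp_mul_tree_inv, e]
    rw [key]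
    refine (H ε).mul_mem ((H ε).mul_mem (treeW_mem ε _ hα) ((H ε).zpow_mem ?_ m)) ((H ε).inv_mem (treeW_mem ε _ hα))
    exact Subgroup.subset_closure (Set.mem_union_right _ ⟨(i, j), by simp [hi, hj], rfl⟩)
  -- (c) the side invariant
  have inv : ∀ (ε : Bool), ∀ w ∈ H ε, (w : LampGroup ℤ).right ∈ rist ε ∧ ∀ x ∈ (Multiplicative.toAdd (w : LampGroup ℤ).left).support, x 0 = ε := by
    intro ε
    refine closure_invariant ε (G ε) fun w hw => ?_
    rcases hw with ⟨t, ht, rfl⟩ | ⟨p, _, rfl⟩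
    · have htr : t ∈ ristG ε := by rw [← hT ε]; exact Subgroup.subset_closure ht
      refine ⟨htr, fun x hx => ?_⟩
      simp [treeW, tree] at hx
    · refine ⟨(rist ε).one_mem, fun x hx => ?_⟩
      have hx' : x = cons ε (((rep p : ↥grigorchukGroup) : Equiv.Perm Ray) rho) := by simpa [lampW, lamp] using hx
      rw [hx']; rfl
  -- (d) the two sides commute, (e) meet trivially
  have comm : ∀ a ∈ H false, ∀ b ∈ H true, Commute a b := by
    refine commute_of_mem_closure fun u hu v hv => ?_
    have fix : ∀ (ε : Bool) (t : ↥grigorchukGroup), t ∈ ristG ε → ∀ p : ℕ × ℕ, treeW t * lampW (!ε) p = lampW (!ε) p * treeW t := by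
      intro ε t ht p
      refine Subtype.ext ?_
      change tree (t : Equiv.Perm Ray) * lamp (cons (!ε) (((rep p : ↥grigorchukGroup) : Equiv.Perm Ray) rho)) (1 : ℤ) =
        lamp (cons (!ε) (((rep p : ↥grigorchukGroup) : Equiv.Perm Ray) rho)) (1 : ℤ) * tree (t : Equiv.Perm Ray)
      rw [← mul_inv_eq_iff_eq_mul, tree_mul_lamp_mul_tree_inv, mem_rist.1 (mem_ristG.1 ht)]
      change (!ε) ≠ ε
      cases ε <;> decide
    rcases hu with ⟨s, hs, rfl⟩ | ⟨p, _, rfl⟩ <;> rcases hv with ⟨t, ht, rfl⟩ | ⟨q, _, rfl⟩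
    · have hs' : s ∈ ristG false := by rw [← hT false]; exact Subgroup.subset_closure hs
      have ht' : t ∈ ristG true := by rw [← hT true]; exact Subgroup.subset_closure ht
      rw [← treeW_mul, ← treeW_mul, (commute_of_mem_ristG hs' ht').eq]
    · exact fix false s (by rw [← hT false]; exact Subgroup.subset_closure hs) q
    · exact (fix true t (by rw [← hT true]; exact Subgroup.subset_closure ht) p).symm
    · have hll : ∀ a b : Multiplicative (Ray →₀ ℤ), (inl a : LampGroup ℤ) * inl b = inl b * inl a := fun a b => by
        rw [← map_mul, ← map_mul, mul_comm]
      exact Subtype.ext (hll _ _)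
  have disj : ∀ w : ↥wreathZ, w ∈ H false → w ∈ H true → w = 1 := by
    intro w h0 h1
    obtain ⟨hr0, hs0⟩ := inv false w h0
    obtain ⟨hr1, hs1⟩ := inv true w h1
    have hl : Multiplicative.toAdd (w : LampGroup ℤ).left = 0 := by
      refine Finsupp.support_eq_empty.1 (Finset.eq_empty_of_forall_notMem fun x hx => ?_)
      have := (hs0 x hx).symm.trans (hs1 x hx)
      exact Bool.false_ne_true this
    refine Subtype.ext (SemidirectProduct.ext ?_ (eq_one_of_mem_rist hr0 hr1))
    change (w : LampGroup ℤ).left = 1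
    rw [← ofAdd_toAdd (w : LampGroup ℤ).left, hl, ofAdd_zero]
  -- (f) infinite, (g) finitely generated
  have inf : ∀ ε : Bool, ((H ε : Subgroup ↥wreathZ) : Set ↥wreathZ).Infinite := by
    intro ε
    haveI := (ristG_infinite ε).to_subtype
    exact Set.infinite_of_injective_forall_mem (f := fun α : ↥((ristG ε : Subgroup ↥grigorchukGroup) : Set ↥grigorchukGroup) => treeW α.1)
      (fun α β h => Subtype.ext (treeW_inj h)) fun α => treeW_mem ε α.1 α.2
  have fg : ∀ ε : Bool, (H ε).FG := fun ε =>
    (Subgroup.fg_iff _).2 ⟨G ε, rfl, ((T ε).finite_toSet.image treeW).union ((Finset.finite_toSet _).image (lampW ε))⟩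
  -- (h) co-bounded
  have cob : ∃ F : Finset ↥wreathZ, ∀ w : ↥wreathZ, ∃ f ∈ F, ∃ a ∈ H false, ∃ b ∈ H true, w * f = a * b := by
    obtain ⟨F, hF⟩ := exists_ristG_coset_reps
    refine ⟨F.image treeW, fun w => ?_⟩
    obtain ⟨f, hf, α, hα, β, hβ, e⟩ := hF ⟨(w : LampGroup ℤ).right, right_mem_grigorchukGroup w.2⟩
    have hsupp : ∀ x ∈ (Multiplicative.toAdd (w : LampGroup ℤ).left).support, ∃ g ∈ grigorchukGroup, g rho = x :=
      exists_apply_rho_of_mem_support w.2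
    obtain ⟨hLF, hLFK⟩ := inl_ofAdd_mem false (H false) (lamp_mem false)
      ((Multiplicative.toAdd (w : LampGroup ℤ).left).filter fun x => x 0 = false) fun x hx => by
        rw [Finsupp.support_filter, Finset.mem_filter] at hx
        exact ⟨hsupp x hx.1, hx.2⟩
    obtain ⟨hLT, hLTK⟩ := inl_ofAdd_mem true (H true) (lamp_mem true)
      ((Multiplicative.toAdd (w : LampGroup ℤ).left).filter fun x => ¬ x 0 = false) fun x hx => by
        rw [Finsupp.support_filter, Finset.mem_filter] at hx
        exact ⟨hsupp x hx.1, by cases h : x 0 <;> simp_all⟩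
    have key : (inl (Multiplicative.ofAdd ((Multiplicative.toAdd (w : LampGroup ℤ).left).filter fun x => x 0 = false)) : LampGroup ℤ) *
        inl (Multiplicative.ofAdd ((Multiplicative.toAdd (w : LampGroup ℤ).left).filter fun x => ¬ x 0 = false)) *
        tree (((⟨(w : LampGroup ℤ).right, right_mem_grigorchukGroup w.2⟩ : ↥grigorchukGroup)) : Equiv.Perm Ray) = (w : LampGroup ℤ) := by
      rw [tree, ← map_mul, ← ofAdd_add, Finsupp.filter_add_filter_not, ofAdd_toAdd]
      exact inl_left_mul_inr_right (w : LampGroup ℤ)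
    set LF : ↥wreathZ := ⟨inl (Multiplicative.ofAdd ((Multiplicative.toAdd (w : LampGroup ℤ).left).filter fun x => x 0 = false)), hLF⟩ with hLFd
    set LT : ↥wreathZ := ⟨inl (Multiplicative.ofAdd ((Multiplicative.toAdd (w : LampGroup ℤ).left).filter fun x => ¬ x 0 = false)), hLT⟩ with hLTd
    set gΓ : ↥grigorchukGroup := ⟨(w : LampGroup ℤ).right, right_mem_grigorchukGroup w.2⟩ with hgΓ
    have hw : LF * LT * treeW gΓ = w := Subtype.ext key
    refine ⟨treeW f, Finset.mem_image_of_mem _ hf, LF * treeW α, (H false).mul_mem hLFK (treeW_mem false α hα), LT * treeW β,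
      (H true).mul_mem hLTK (treeW_mem true β hβ), ?_⟩
    calc w * treeW f = LF * LT * (treeW gΓ * treeW f) := by rw [← mul_assoc, hw]
      _ = LF * LT * (treeW α * treeW β) := by rw [← treeW_mul, e, treeW_mul]
      _ = LF * (LT * treeW α) * treeW β := by simp only [mul_assoc]
      _ = LF * (treeW α * LT) * treeW β := by rw [← (comm _ (treeW_mem false α hα) _ hLTK).eq]
      _ = LF * treeW α * (LT * treeW β) := by simp only [mul_assoc]
  exact OneEnd.end_existsUnique_of_commuting_subgroups S hS (H false) (H true) (fg false) (fg true) (inf false) (inf true) comm disj cob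

/-- **THE FRONTIER GRAPH `Cay(ℤ ≀_X 𝔊; a, b, c, d, s)` (V164's graph, `Cay`) has EXACTLY ONE END.** [cite: BartholdiErschler2012, Thm. 5.3 (the group)]
[cite: BenjaminiSchramm1996, Def. 1 (p. 75)] -/
theorem cay_existsUnique_end : ∃! e, e ∈ Cay.end := wreathZ_cayley_gens_existsUnique_end _ closure_standardGens_finset

/-- **CONSISTENCY INSTANCE of Benjamini–Schramm's Question 3 / Lyons–Peres Conj. 7.27 ON THE FRONTIER GRAPH**: connected, vertex-transitive
(`MulAction.IsPretransitive (G ≃g G) V`) and quasi-transitive, EXACTLY ONE END, and `p_u < 1` (p624625) — all kernel.  An instance, NOT evidence about the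
questions (their content is non-amenable); they stay OPEN. [cite: BenjaminiSchramm1996, Question 3 (p. 79)] [cite: LyonsPeres2016, §7.6 Conj. 7.27, Thm. 7.6] -/
theorem cay_question3_instance : (mulCayley (↑stdGens : Set ↥wreathZ)).Connected ∧
    MulAction.IsPretransitive (mulCayley (↑stdGens : Set ↥wreathZ) ≃g mulCayley (↑stdGens : Set ↥wreathZ)) ↥wreathZ ∧
    IsQuasiTransitive (mulCayley (↑stdGens : Set ↥wreathZ)) ∧ (∃! e, e ∈ (mulCayley (↑stdGens : Set ↥wreathZ)).end) ∧
    uniquenessProb (mulCayley (↑stdGens : Set ↥wreathZ)) < 1 :=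
  ⟨cay_connected, isPretransitive_aut_mulCayley _, cay_isQuasiTransitive, wreathZ_cayley_gens_existsUnique_end _ closure_standardGens_finset,
    cay_uniquenessProb_lt_one⟩

/-- The same for EVERY finite generating set `S` of `Γ₂` (Conj. 7.27 shape: connected, quasi-transitive, one end, `p_u < 1` — p624625 `cayley_gens_uniquenessProb`).
[cite: LyonsPeres2016, §7.6 Conj. 7.27, Thm. 7.6] -/
theorem wreathZ_cayley_gens_conj_7_27_instance (S : Finset ↥wreathZ) (hS : Subgroup.closure (↑S : Set ↥wreathZ) = ⊤) :
    (mulCayley (↑S : Set ↥wreathZ)).Connected ∧ IsQuasiTransitive (mulCayley (↑S : Set ↥wreathZ)) ∧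
      (∃! e, e ∈ (mulCayley (↑S : Set ↥wreathZ)).end) ∧ uniquenessProb (mulCayley (↑S : Set ↥wreathZ)) < 1 :=
  ⟨CayleyScaled.connected_mulCayley_of_closure S hS, CayleyScaled.isQuasiTransitive_mulCayley S, wreathZ_cayley_gens_existsUnique_end S hS,
    (cayley_gens_uniquenessProb S hS 1).2⟩

end Grigorchuk

end Summit.CriticalPhenomena.PercolationContinuityZ3.Theorems.Transplant

end
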